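import Literature.IUT.LogThetaLattice.PacketLogVolumesHaarModel
import Literature.IUT.LogVolume.Corollary22TwoAdicIntegrality
import HarnessLib

/-!
# [IUTchIII] Proposition 3.9 (i): the two PACKET-NORMALISATIONS ("`×p_v ↦ −log p_v`", "`×e ↦ +log e`") as
# theorems of Haar measure at the genuine adelic model (abc-iut cell, layer L6)

S. Mochizuki, *Inter-universal Teichmüller theory III*, kurims manuscript (May 2020), §3, Proposition 3.9 (i)
[claim: Mochizuki2012, status: disputed], p. 115 (finite `v_ℚ`): "Here, we assume that these log-volumes are
normalized so that multiplication of an element of "`𝕄(−)`" by `p_v` corresponds to adding the quantity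
`−log(p_v) ∈ ℝ`; we shall refer to this normalization as the packet-normalization."; p. 116 (archimedean
`v_ℚ`): "Here, we assume that these log-volumes are normalized so that multiplication of an element of "`𝕄(−)`"
by `e = 2.71828...` corresponds to adding the quantity `1 = log(e) ∈ ℝ`; we shall refer to this normalization as
the packet-normalization." Remark 3.1.1 (ii), p. 94: the normalized weights are "normalized so that
multiplication by `p_{v_ℚ}` affects log-volumes by addition or subtraction [that is to say, depending on whether
`v_ℚ ∈ 𝕍^arc_ℚ` or `v_ℚ ∈ 𝕍^non_ℚ`] of the quantity `log(p_{v_ℚ}) ∈ ℝ`."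

In `PacketLogVolumesHaarModel.lean` (abc-iut-L6-d3) the packet log-volume `μ^log_{v_ℚ}(T) = Σ_{v|v_ℚ} c_v·log μ_v(T_v)`
is DEFINED on the genuine packets `⊕_{v|v_ℚ} F_v` (Haar volumes `μ_v(𝒪_v) = 1` on Mathlib's completions, radial
volume on `ℂ`) with the weights `c_v` of Remark 3.1.1 (ii) — so the two "we assume … normalized" sentences
become CHECKABLE. This proof file checks them (abc-iut-L6-t4's abstract `packetLogVolume_packetNormalized(_arch)`
of `PacketLogVolumes.lean` proved the same shape from a scaling HYPOTHESIS `μ_i(p·T_i) = p^{-d_i}μ_i(T_i)` and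
`Σ w_i d_i = 1`; here both are theorems):
* `packetPrimeEquiv` / `packetInftyEquiv`: the packet `{v | p}` IS `V(F)_p` (`placesOver F p`) and `{v | ∞}` IS
  the set of archimedean places (bookkeeping for the gen-2 index type `Packet F v_ℚ`);
* **`packetLogModulus_prime_self : Σ_{v|p} c_v·log‖p‖_v = −log p`** — since `‖p‖_v = q_v^{-ord_v(p)} =
  p^{-e_v f_v}` (`ord_v(p) = e_v`: campaign-S `ord_natCast_eq_ramIdx`) and `Σ_{v|p} e_v f_v = [F:ℚ]`
  (`sum_localDegree`); hence **`haarPacketLogVolume_prime_natCast_smul`**: `μ^log_p(p·T) = μ^log_p(T) − log p`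
  for EVERY region `T` of the packet at `p` — the nonarchimedean packet-normalisation, as printed;
* `packetLogModulus_prime_of_ne : Σ_{v|ℓ} c_v·log‖p‖_v = 0` for a prime `ℓ ≠ p` (`p` is a unit at `v ∤ p`);
* **`haarPacketLogVolume_infty_smul`**: multiplying every complex summand of a region of the archimedean packet
  by `c ∈ ℂ^×` adds `log|c|` (`Σ_w c_w = 1`, `sum_haarWeight_arch`; radial `μ(c·A) = |c|·μ(A)`); at `c = e`:
  **`haarPacketLogVolume_infty_exp_smul`**: `μ^log_∞(e·T) = μ^log_∞(T) + 1` — the archimedean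
  packet-normalisation, as printed;
* `packetLogModulus_infty : Σ_{w|∞} c_w·log|f|_w = log|N_{F/ℚ}(f)|/[F:ℚ]` (Mathlib `InfinitePlace.prod_eq_abs_norm`),
  e.g. `= + log p` for `f = p` — Remark 3.1.1 (ii)'s "addition or subtraction [depending on whether `v_ℚ ∈ 𝕍^arc_ℚ`
  or `v_ℚ ∈ 𝕍^non_ℚ`] of the quantity `log(p_{v_ℚ})`", both signs now theorems, summing to `0` (product formula).

HONEST SCOPE as in the model file (`K = F_mod = F`, `|A| = 1`, archimedean summand `ℂ` with the radial volume —
all archimedean places of the totally complex `F` of [IUTchI] Def. 3.1 (b) are complex). Nothing here asserts a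
disputed claim or takes a side on [IUTchIII] Cor. 3.12; the mathematics is classical (Haar measure, `Σ e_v f_v =
[F:ℚ]`, `∏_w |f|_w^{[F_w:ℝ]} = |N(f)|`). Proof-only apart from the two index equivalences and the scaling map
`archSmul` (definitions of bookkeeping nature).
-/

noncomputable section

namespace Literature.IUT.LogThetaLattice

open Literature.IUT.LogVolume NumberField IsDedekindDomain MeasureTheory Metric Set
open scoped ENNReal NNReal Pointwise

variable (F : Type) [Field F] [NumberField F]

/-! ### The packets `{v | p} = V(F)_p` and `{v | ∞} = 𝕍(F)^arc` -/

omit [NumberField F] in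
/-- No archimedean place lies over a prime. [claim: Mochizuki2012, status: disputed] -/
theorem ratPlaceBelow_inl_ne_prime (w : InfinitePlace F) (p : Nat.Primes) :
    ratPlaceBelow F (Sum.inl w) ≠ RatPlace.prime p := by
  simp [ratPlaceBelow]

omit [NumberField F] in
/-- No finite place lies over `∞`. [claim: Mochizuki2012, status: disputed] -/
theorem ratPlaceBelow_inr_ne_infty (v : HeightOneSpectrum (𝓞 F)) :
    ratPlaceBelow F (Sum.inr v) ≠ RatPlace.infty := by
  simp [ratPlaceBelow]

/-- **The packet over `p` is `V(F)_p`**: `{v ∈ 𝕍(F) : v | p} ≃ placesOver F p`.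
[claim: Mochizuki2012, status: disputed] -/
def packetPrimeEquiv (p : Nat.Primes) :
    Packet F (RatPlace.prime p) ≃ {v : HeightOneSpectrum (𝓞 F) // v ∈ placesOver F (p : ℕ)} where
  toFun v := match v with
    | ⟨Sum.inr w, h⟩ => ⟨w, (ratPlaceBelow_inr_eq_prime_iff F w p).mp h⟩
    | ⟨Sum.inl w, h⟩ => absurd h (ratPlaceBelow_inl_ne_prime F w p)
  invFun w := ⟨Sum.inr w.1, (ratPlaceBelow_inr_eq_prime_iff F w.1 p).mpr w.2⟩
  left_inv v := by
    rcases v with ⟨w | w, h⟩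
    · exact absurd h (ratPlaceBelow_inl_ne_prime F w p)
    · rfl
  right_inv w := rfl

/-- **The packet over `∞` is `𝕍(F)^arc`**: `{v ∈ 𝕍(F) : v | ∞} ≃ InfinitePlace F`.
[claim: Mochizuki2012, status: disputed] -/
def packetInftyEquiv : Packet F RatPlace.infty ≃ InfinitePlace F where
  toFun v := match v with
    | ⟨Sum.inl w, _⟩ => w
    | ⟨Sum.inr w, h⟩ => absurd h (ratPlaceBelow_inr_ne_infty F w)
  invFun w := ⟨Sum.inl w, rfl⟩
  left_inv v := by
    rcases v with ⟨w | w, h⟩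
    · rfl
    · exact absurd h (ratPlaceBelow_inr_ne_infty F w)
  right_inv w := rfl

/-- Sums over the packet at `p` are sums over `V(F)_p`. [claim: Mochizuki2012, status: disputed] -/
theorem sum_packet_prime (p : Nat.Primes) (g : Place F → ℝ) :
    ∑ v : Packet F (RatPlace.prime p), g v.1 = ∑ v ∈ placesOver F (p : ℕ), g (Sum.inr v) := by
  rw [← Finset.sum_coe_sort (placesOver F (p : ℕ))]
  exact Fintype.sum_equiv (packetPrimeEquiv F p) _
    (fun w : {v : HeightOneSpectrum (𝓞 F) // v ∈ placesOver F (p : ℕ)} => g (Sum.inr w.1)) (by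
      rintro ⟨w | w, h⟩
      · exact absurd h (ratPlaceBelow_inl_ne_prime F w p)
      · rfl)

/-- Sums over the packet at `∞` are sums over the archimedean places. [claim: Mochizuki2012, status: disputed] -/
theorem sum_packet_infty (g : Place F → ℝ) :
    ∑ v : Packet F RatPlace.infty, g v.1 = ∑ w : InfinitePlace F, g (Sum.inl w) :=
  Fintype.sum_equiv (packetInftyEquiv F) _ (fun w => g (Sum.inl w)) (by
    rintro ⟨w | w, h⟩
    · rfl
    · exact absurd h (ratPlaceBelow_inr_ne_infty F w))

/-! ### Nonarchimedean packet-normalisation: `×p ↦ −log p` -/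

/-- **[IUTchIII] Rmk. 3.1.1 (ii), per summand** (p. 94: multiplication by `p_{v_ℚ}` changes the log-volume of the
summand `K_v` by `[K_v:ℚ_{v_ℚ}]·log(p_{v_ℚ})`, whence the normalized weights): `log‖p‖_v = −[F_v:ℚ_p]·log p` at
`v | p` — classical: `‖p‖_v = q_v^{-ord_v(p)}` (Mathlib `adicAbv`), `ord_v(p) = e_v` (campaign-S
`Cor22.ord_natCast_eq_ramIdx`), `q_v = p^{f_v}`, `[F_v:ℚ_p] = e_v f_v` (`localDegree`).
[claim: Mochizuki2012, status: disputed] -/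
theorem log_adicAbv_natCast_prime (p : Nat.Primes) {v : HeightOneSpectrum (𝓞 F)} (hv : v ∈ placesOver F (p : ℕ)) :
    Real.log (NumberField.HeightOneSpectrum.adicAbv F v (p : F)) = -(localDegree F v * Real.log p) := by
  haveI : Fact (p : ℕ).Prime := ⟨p.2⟩
  have hp0 : ((p : ℕ) : F) ≠ 0 := by exact_mod_cast p.2.ne_zero
  rw [adicAbv_eq_absNorm_zpow F v hp0, Real.log_zpow, Cor22.ord_natCast_eq_ramIdx (p : ℕ) v hv]
  have hq : Real.log (Ideal.absNorm v.asIdeal : ℝ) = resDeg F v * Real.log p := by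
    rw [← (mem_placesOver_iff_residueChar v).mp hv]
    exact logNorm_eq F v
  rw [hq, localDegree]
  push_cast
  ring

/-- **Nonarchimedean packet-normalisation** ([IUTchIII] Prop. 3.9 (i) p. 115 / Rmk. 3.1.1 (ii) p. 94): the
weighted shift of the packet at `p` under multiplication by `p` is `Σ_{v|p} (1/[F:ℚ])·log‖p‖_v =
−(Σ_{v|p} e_v f_v / [F:ℚ])·log p = −log p` (`sum_localDegree`). [claim: Mochizuki2012, status: disputed] -/
theorem packetLogModulus_prime_self (p : Nat.Primes) :
    packetLogModulus F (Units.mk0 ((p : ℕ) : F) (by exact_mod_cast p.2.ne_zero)) (RatPlace.prime p) =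
      -Real.log p := by
  haveI : Fact (p : ℕ).Prime := ⟨p.2⟩
  have hg := sum_packet_prime F p (fun v => haarWeight F v * Real.log ((placeDatum F v).modulus ((p : ℕ) : F)))
  simp only [packetLogModulus, Units.val_mk0] at hg ⊢
  rw [hg]
  simp only [placeDatum_inr, nonarchDatum_modulus, haarWeight_inr]
  rw [Finset.sum_congr rfl fun v hv => by rw [log_adicAbv_natCast_prime F p hv]]
  have hd : (Module.finrank ℚ F : ℝ) ≠ 0 := (FinDivisor.finrank_pos (F := F)).ne'
  have hsum : ∑ v ∈ placesOver F (p : ℕ), (localDegree F v : ℝ) = Module.finrank ℚ F := by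
    exact_mod_cast sum_localDegree F (p : ℕ)
  calc ∑ v ∈ placesOver F (p : ℕ), 1 / (Module.finrank ℚ F : ℝ) * -((localDegree F v : ℝ) * Real.log p)
      = -(Real.log p / Module.finrank ℚ F) * ∑ v ∈ placesOver F (p : ℕ), (localDegree F v : ℝ) := by
        rw [Finset.mul_sum]
        exact Finset.sum_congr rfl fun v _ => by ring
    _ = -Real.log p := by rw [hsum]; field_simp

/-- At a prime `ℓ ≠ p` the packet does not move under `p`: `‖p‖_v = 1` for `v | ℓ` (`ord_v(p) = 0` off `V(F)_p`),
so `Σ_{v|ℓ} c_v·log‖p‖_v = 0`. [claim: Mochizuki2012, status: disputed] -/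
theorem packetLogModulus_prime_of_ne (p ℓ : Nat.Primes) (hℓ : ℓ ≠ p) :
    packetLogModulus F (Units.mk0 ((p : ℕ) : F) (by exact_mod_cast p.2.ne_zero)) (RatPlace.prime ℓ) = 0 := by
  haveI : Fact (p : ℕ).Prime := ⟨p.2⟩
  haveI : Fact (ℓ : ℕ).Prime := ⟨ℓ.2⟩
  have hg := sum_packet_prime F ℓ (fun v => haarWeight F v * Real.log ((placeDatum F v).modulus ((p : ℕ) : F)))
  simp only [packetLogModulus, Units.val_mk0] at hg ⊢
  rw [hg]
  refine Finset.sum_eq_zero fun v hv => ?_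
  simp only [placeDatum_inr, nonarchDatum_modulus, haarWeight_inr]
  have hp0 : ((p : ℕ) : F) ≠ 0 := by exact_mod_cast p.2.ne_zero
  -- `v ∤ p`: the integer `p` is a unit at `v`, `‖p‖_v = 1`
  have hone : NumberField.HeightOneSpectrum.adicAbv F v ((p : ℕ) : F) = 1 := by
    by_contra hne
    have hord : ord F v ((p : ℕ) : F) ≠ 0 := (ord_ne_zero_iff_adicAbv_ne_one F v hp0).mpr hne
    -- `ord_v(p) ≠ 0` forces `v | p`
    have hvp : v ∈ placesOver F (p : ℕ) := by
      refine Cor22.mem_placesOver_of_natCast_mem (p : ℕ) v ?_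
      have hcast : (((p : ℕ) : 𝓞 F) : F) = ((p : ℕ) : F) := by simp
      have hval : v.valuation F (((p : ℕ) : 𝓞 F) : F) < 1 := by
        refine lt_of_le_of_ne (v.valuation_le_one _) fun h => hord ?_
        rw [hcast] at h
        simp [ord, h]
      exact (v.valuation_lt_one_iff_mem _).mp hval
    have h1 := (mem_placesOver_iff_residueChar v).mp hv
    have h2 := (mem_placesOver_iff_residueChar v).mp hvp
    exact hℓ (Subtype.ext (h1.symm.trans h2))
  rw [hone, Real.log_one, mul_zero]

/-- **[IUTchIII] Prop. 3.9 (i), nonarchimedean packet-normalisation, AS PRINTED**: "multiplication of an element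
of "`𝕄(−)`" by `p_v` corresponds to adding the quantity `−log(p_v) ∈ ℝ`" — for EVERY region `T = (T_v)_{v|p}` of
the genuine packet `⊕_{v|p} F_v`: `μ^log_p(p·T) = μ^log_p(T) − log p`. [claim: Mochizuki2012, status: disputed] -/
theorem haarPacketLogVolume_prime_natCast_smul (p : Nat.Primes)
    (T : ∀ v : Packet F (RatPlace.prime p), (placeDatum F v.1).Adm) :
    haarPacketLogVolume F (RatPlace.prime p)
        (fun v => (placeDatum F v.1).actAdm (Units.mk0 ((p : ℕ) : F) (by exact_mod_cast p.2.ne_zero)) (T v)) =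
      haarPacketLogVolume F (RatPlace.prime p) T - Real.log p := by
  rw [haarPacketLogVolume_actAdm, packetLogModulus_prime_self, sub_eq_add_neg]

/-! ### Archimedean packet-normalisation: `×e ↦ +log e` -/

/-- Scaling the summand of a region of the archimedean packet by a complex number `c ≠ 0` (the archimedean
packet consists of complex summands only: `{v | ∞} = 𝕍(F)^arc`). [claim: Mochizuki2012, status: disputed] -/
def archSmul (c : ℂ) (hc : c ≠ 0) :
    ∀ v : Packet F RatPlace.infty, (placeDatum F v.1).Adm → (placeDatum F v.1).Adm
  | ⟨Sum.inl _, _⟩, T => ⟨c • (id T.1 : Set ℂ), by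
      show 0 < radialVolume (c • (id T.1 : Set ℂ)) ∧ radialVolume (c • (id T.1 : Set ℂ)) < ∞
      rw [radialVolume_smul]
      exact ⟨ENNReal.mul_pos (by simpa using hc) T.2.1.ne', ENNReal.mul_lt_top ENNReal.ofReal_lt_top T.2.2⟩⟩
  | ⟨Sum.inr w, h⟩, _ => absurd h (ratPlaceBelow_inr_ne_infty F w)

/-- On each complex summand, scaling by `c` adds `log|c|` to the radial log-volume ([AbsTopIII] Prop. 5.7
(ii)(b), campaign-S `radialLogVolume_smul`). [claim: Mochizuki2012, status: disputed] -/
theorem logVol_archSmul (c : ℂ) (hc : c ≠ 0) (w : InfinitePlace F)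
    (T : (placeDatum F (Sum.inl w)).Adm) :
    (placeDatum F (Sum.inl w)).logVol (archSmul F c hc ⟨Sum.inl w, rfl⟩ T).1 =
      (placeDatum F (Sum.inl w)).logVol T.1 + Real.log ‖c‖ := by
  have h := radialLogVolume_smul (A := (id T.1 : Set ℂ)) hc T.2.1 T.2.2
  rw [radialMulLogVolume_eq] at h
  exact h

/-- **Archimedean scaling law for the packet**: multiplying every complex summand of a region of the archimedean
packet by `c ∈ ℂ^×` adds `(Σ_w c_w)·log|c| = log|c|` to `μ^log_∞` (the weights `c_w = [F_w:ℝ]/[F:ℚ]` sum to `1`,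
`sum_haarWeight_arch`). [claim: Mochizuki2012, status: disputed] -/
theorem haarPacketLogVolume_infty_smul (c : ℂ) (hc : c ≠ 0)
    (T : ∀ v : Packet F RatPlace.infty, (placeDatum F v.1).Adm) :
    haarPacketLogVolume F RatPlace.infty (fun v => archSmul F c hc v (T v)) =
      haarPacketLogVolume F RatPlace.infty T + Real.log ‖c‖ := by
  unfold haarPacketLogVolume
  rw [← Fintype.sum_equiv (packetInftyEquiv F).symm
      (fun w => haarWeight F (Sum.inl w) *
        (placeDatum F (Sum.inl w)).logVol (archSmul F c hc ⟨Sum.inl w, rfl⟩ (T ⟨Sum.inl w, rfl⟩)).1)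
      _ (fun _ => rfl),
    ← Fintype.sum_equiv (packetInftyEquiv F).symm
      (fun w => haarWeight F (Sum.inl w) * (placeDatum F (Sum.inl w)).logVol (T ⟨Sum.inl w, rfl⟩).1)
      _ (fun _ => rfl)]
  simp only [logVol_archSmul, mul_add, Finset.sum_add_distrib, ← Finset.sum_mul, sum_haarWeight_arch, one_mul]

/-- **[IUTchIII] Prop. 3.9 (i), archimedean packet-normalisation, AS PRINTED**: "multiplication of an element of
"`𝕄(−)`" by `e = 2.71828...` corresponds to adding the quantity `1 = log(e) ∈ ℝ`" — for EVERY region `T` of the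
genuine archimedean packet `⊕_{w|∞} ℂ`: `μ^log_∞(e·T) = μ^log_∞(T) + 1`. [claim: Mochizuki2012, status: disputed] -/
theorem haarPacketLogVolume_infty_exp_smul (T : ∀ v : Packet F RatPlace.infty, (placeDatum F v.1).Adm) :
    haarPacketLogVolume F RatPlace.infty
        (fun v => archSmul F ((Real.exp 1 : ℝ) : ℂ) (by exact_mod_cast (Real.exp_pos 1).ne') v (T v)) =
      haarPacketLogVolume F RatPlace.infty T + 1 := by
  rw [haarPacketLogVolume_infty_smul, Complex.norm_real, Real.norm_eq_abs, abs_of_pos (Real.exp_pos 1),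
    Real.log_exp]

/-- **The archimedean packet under `f ∈ F^×`**: `Σ_{w|∞} c_w·log|f|_w = log|N_{F/ℚ}(f)| / [F:ℚ]` (Mathlib's
`InfinitePlace.prod_eq_abs_norm`: `∏_w |f|_w^{[F_w:ℝ]} = |N(f)|`) — Remark 3.1.1 (ii)'s "addition … of the quantity
`log(p_{v_ℚ})`" at `v_ℚ ∈ 𝕍^arc_ℚ` for `f = p` (`N(p) = p^{[F:ℚ]}`). [claim: Mochizuki2012, status: disputed] -/
theorem packetLogModulus_infty (f : Fˣ) :
    packetLogModulus F f RatPlace.infty =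
      Real.log (∏ w : InfinitePlace F, w (f : F) ^ w.mult) / Module.finrank ℚ F := by
  have hg := sum_packet_infty F (fun v => haarWeight F v * Real.log ((placeDatum F v).modulus (f : F)))
  simp only [packetLogModulus] at hg ⊢
  rw [hg]
  simp only [placeDatum_inl, archDatum_modulus, haarWeight_inl]
  have hpos : ∀ w ∈ (Finset.univ : Finset (InfinitePlace F)), (w (f : F)) ^ w.mult ≠ 0 :=
    fun w _ => pow_ne_zero _ (InfinitePlace.pos_iff.mpr f.ne_zero).ne'
  rw [Real.log_prod hpos, Finset.sum_div]
  refine Finset.sum_congr rfl fun w _ => ?_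
  rw [Real.log_pow]
  ring

/-- In particular for `f = p`: `Σ_{w|∞} c_w·log|p|_w = +log p` (`|p|_w = p` at every archimedean `w`,
`Σ_w [F_w:ℝ] = [F:ℚ]`). Together with `packetLogModulus_prime_self` (`−log p` at `v_ℚ = p`) and
`packetLogModulus_prime_of_ne` (`0` elsewhere) this is the product formula for `p`, packet by packet.
[claim: Mochizuki2012, status: disputed] -/
theorem packetLogModulus_infty_natCast (p : Nat.Primes) :
    packetLogModulus F (Units.mk0 ((p : ℕ) : F) (by exact_mod_cast p.2.ne_zero)) RatPlace.infty = Real.log p := by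
  have hg := sum_packet_infty F (fun v => haarWeight F v * Real.log ((placeDatum F v).modulus ((p : ℕ) : F)))
  simp only [packetLogModulus, Units.val_mk0] at hg ⊢
  rw [hg]
  simp only [placeDatum_inl, archDatum_modulus, haarWeight_inl, ← InfinitePlace.norm_embedding_eq, map_natCast,
    Complex.norm_natCast]
  rw [← Finset.sum_mul]
  have h := sum_haarWeight_arch F
  simp only [haarWeight_inl] at h
  rw [h, one_mul]

end Literature.IUT.LogThetaLattice

end
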